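import Summits.Langlands.Langlands.Theses.CompatibleFamilySplit
import Summits.Langlands.Langlands.Theorems.EisensteinDegreeShiftSectorComplementStubAvatarConjugacy
import HarnessLib

/-!
# `CompatibleFamilySplit.AvatarConjugacy` (stmt-Langlands-18970) — proved BY NAME

The support item U of `route-Langlands-CompatibleFamilySplit` is, up to namespace qualification
(`cofinite` / `Filter.cofinite`, `SatakeFrobCompatibleAt` / `Summit.Langlands.SatakeFrobCompatibleAt`,
`IsConjugate` / `Summit.Langlands.IsConjugate`), the SAME proposition as the closed item
`PrimeSwitchSplit.AvatarConjugacy` (stmt-Langlands-17844), proved in the tree as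
`Summit.Langlands.Langlands.Theorems.EisensteinDegreeShiftSectorComplement.stub_avatarConjugacy`
(uniqueness of the irreducible Satake avatar up to `GL_n(ℚ̄_ℓ)`-conjugacy: Chebotarev density +
Brauer–Nesbitt + irreducibility transfer; Deligne–Serre 1974, Lemme 3.2 — landed theorem
`ReciprocityUpToIrreducibility.isConjugate_of_satakeFrobCompatibleAt`).  The two ledger items were not
merged by signature dedup only because of the qualification differences; this file closes 18970 by the
landed theorem, term-for-term.  No Literature named fact is consumed.
-/

namespace Summit.Langlands.Langlands.Theorems

set_option linter.dupNamespace false in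
/-- **stmt-Langlands-18970** `CompatibleFamilySplit.AvatarConjugacy`, by the landed theorem
`EisensteinDegreeShiftSectorComplement.stub_avatarConjugacy` (same statement; Deligne–Serre 1974,
Lemme 3.2). -/
theorem compatibleFamilySplit_avatarConjugacy_proof :
    Summit.Langlands.Langlands.Theses.CompatibleFamilySplit.AvatarConjugacy :=
  fun K _ _ n hcpt π ℓ _ ι ρ₀ ρ h₀ hρ₀ hρ =>
    EisensteinDegreeShiftSectorComplement.stub_avatarConjugacy K n hcpt π ℓ ι ρ₀ ρ h₀ hρ₀ hρ

end Summit.Langlands.Langlands.Theorems
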